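import Literature.Analysis.FluidPDE.PalmLocalState
import Literature.MathematicalPhysics.KineticTheory.RegularStationaryState

/-!
# Negative lemmas for `PesinPricing.PricedBoltzmannHypothesis` (stmt-AtomisticToContinuum-9730):
# Palm hard-sphere states are never Gibbs mixtures

Support file (refuter, crux-attack gen-2 of the informal glue `PricedBoltzmannHypothesis`; everything
proved, no definitions, no named facts). The glue takes local limits "in the sense of URegularLimits
(i)–(iii): tag a typical particle, recentre, blow up" — the rooted local state `R_N`
(`Literature.Analysis.FluidPDE.rootedLocalState`) whose limit points the repaired Kifer–Young crux
`KiferYoungUpperR` (stmt-13790) locates in the Palm class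
`𝓛(σ,e₀) = Literature.Analysis.FluidPDE.IsPalmHardSphereState σ e₀` — and concludes "hence ν is a
mixture of Gibbs laws `g_{z,u,β}`", the conclusion class
`Literature.MathematicalPhysics.KineticTheory.IsHardSphereGibbsMixture` of the repaired rigidity crux
`PesinSaturationRigidityR` (stmt-13806 (a′)). The two classes are DISJOINT, so as worded the
conclusion fails for every local limit, including the equilibrium one (constant profiles, where the
local limit is the Palm law of the equilibrium Gibbs state): the glue must classify the stationary
law `P` behind `Q = palmLaw P` (Palm inversion, `PalmUniqueness`) or be stated in OVY's site-rooted
frame (`IsOVYLimitState`).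

* `measure_isRooted_eq_zero_of_isHardSphereGibbs` — a DLR Gibbs state of the hard-sphere gas gives
  mass `0` to the rooted configurations `{ω | ∃ v, (0, v) ∈ ω}` (the specification throws positions
  with Lebesgue density; no translation invariance needed);
* `measure_isRooted_eq_zero_of_isHardSphereGibbsMixture` — hence so does every Gibbs mixture;
* `not_isHardSphereGibbsMixture_of_ae_isRooted`, `IsPalmHardSphereState.not_isHardSphereGibbsMixture`,
  `palmLaw_not_isHardSphereGibbsMixture` — a nonzero law carried by rooted configurations (every member
  of `𝓛(σ,e₀)`, `σ > 0`; every Palm law of positive finite intensity) is not a Gibbs mixture, at any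
  diameter.

## References

* R. Alexander, *Time evolution for infinitely many hard spheres*, CMP 49 (1976), §2.1 (2.1.1).
  [Alexander1976]
* G. Last, M. Penrose, *Lectures on the Poisson Process* (2017), (9.4)–(9.7). [LastPenrose2017]
-/

open MeasureTheory Set Filter Function
open scoped ENNReal

namespace Summit.AtomisticToContinuum.HydrodynamicLimit.Theorems.PricedBoltzmannHypothesis.Negative

open Literature.Analysis.FluidPDE Literature.Analysis.FunctionSpaces
open Literature.MathematicalPhysics.KineticTheory

section GibbsNotRooted

variable {d : Type*} [Fintype d] [Nonempty d]


/-- The one-particle a priori measure puts no mass on `{position = 0}`. [folklore] -/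
theorem maxwellPhaseMeasure_fst_zero (β : ℝ) (u : (EuclideanSpace ℝ d)) (Λ : Set (EuclideanSpace ℝ d)) :
    maxwellPhaseMeasure β u Λ (Prod.fst ⁻¹' {0}) = 0 := by
  have h0 : (volume.restrict Λ) ({0} : Set (EuclideanSpace ℝ d)) = 0 :=
    nonpos_iff_eq_zero.1 ((Measure.le_iff'.1 Measure.restrict_le_self {0}).trans_eq
      (measure_singleton (0 : (EuclideanSpace ℝ d))))
  haveI : SigmaFinite (maxwellPhaseMeasure β u Λ) := by unfold maxwellPhaseMeasure; infer_instance
  rw [maxwellPhaseMeasure, ← Set.prod_univ]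
  exact nonpos_iff_eq_zero.1 ((Measure.prod_prod_le _ _).trans_eq (by rw [h0, zero_mul]))

/-- In the `k`-particle a priori measure, a.s. no thrown particle sits exactly at the origin.
[folklore] -/
theorem pi_maxwellPhaseMeasure_exists_fst_zero (β : ℝ) (u : (EuclideanSpace ℝ d)) (Λ : Set (EuclideanSpace ℝ d)) (k : ℕ) :
    Measure.pi (fun _ : Fin k => maxwellPhaseMeasure β u Λ) {x | ∃ i, (x i).1 = 0} = 0 := by
  have h : {x : Fin k → (EuclideanSpace ℝ d) × (EuclideanSpace ℝ d) | ∃ i, (x i).1 = 0} = ⋃ i, eval i ⁻¹' (Prod.fst ⁻¹' {0}) := by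
    ext x; simp
  haveI : SigmaFinite (maxwellPhaseMeasure β u Λ) := by unfold maxwellPhaseMeasure; infer_instance
  rw [h]
  exact measure_iUnion_null fun i =>
    Measure.pi_eval_preimage_null _ (maxwellPhaseMeasure_fst_zero β u Λ)

omit [Fintype d] [Nonempty d] in
/-- A superposition `(x ∩ Λ) ∪ (Y ∩ Λᶜ)` with `0 ∈ Λ` is rooted only if some thrown particle is at
the origin. [folklore] -/
theorem exists_fst_zero_of_isRooted_superposeIn {Λ : Set (EuclideanSpace ℝ d)} (hΛ : (0 : (EuclideanSpace ℝ d)) ∈ Λ) {k : ℕ}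
    {x : Fin k → (EuclideanSpace ℝ d) × (EuclideanSpace ℝ d)} {Y : PointConfig ((EuclideanSpace ℝ d) × (EuclideanSpace ℝ d))} (h : IsRooted (superposeIn Λ x Y)) :
    ∃ i, (x i).1 = 0 := by
  obtain ⟨v, hv⟩ := h
  rcases (show ((0 : (EuclideanSpace ℝ d)), v) ∈ (superposeIn Λ x Y).carrier from hv) with ⟨⟨i, hi⟩, -⟩ | ⟨-, hc⟩
  · exact ⟨i, by rw [hi]⟩
  · exact absurd hΛ hc

/-- The Gibbs weight of any event made of rooted configurations vanishes (window `Λ ∋ 0`). [folklore] -/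
theorem gibbsWeight_eq_zero_of_subset_isRooted (ε z β : ℝ) (u : (EuclideanSpace ℝ d)) {Λ : Set (EuclideanSpace ℝ d)} (hΛ : (0 : (EuclideanSpace ℝ d)) ∈ Λ)
    (Y : PointConfig ((EuclideanSpace ℝ d) × (EuclideanSpace ℝ d))) {A : Set (PointConfig ((EuclideanSpace ℝ d) × (EuclideanSpace ℝ d)))} (hA : A ⊆ {ω | IsRooted ω}) :
    gibbsWeight ε z β u Λ Y A = 0 := by
  rw [gibbsWeight]
  refine ENNReal.tsum_eq_zero.2 fun k => ?_
  have hint : ∫⁻ x : Fin k → (EuclideanSpace ℝ d) × (EuclideanSpace ℝ d), (A ∩ {X | HardCoreIn ε Λ X}).indicator 1 (superposeIn Λ x Y)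
      ∂(Measure.pi fun _ : Fin k => maxwellPhaseMeasure β u Λ) = 0 := by
    refine (lintegral_congr_ae ?_).trans lintegral_zero
    have hnull := pi_maxwellPhaseMeasure_exists_fst_zero β u Λ k
    rw [← compl_mem_ae_iff] at hnull
    filter_upwards [hnull] with x hx
    refine Set.indicator_of_notMem (fun hmem => hx ?_) _
    exact exists_fst_zero_of_isRooted_superposeIn hΛ (hA hmem.1)
  rw [hint, mul_zero]

/-- The Gibbs specification gives mass `0` to rooted events (window `Λ ∋ 0`). [folklore] -/
theorem gibbsSpec_eq_zero_of_subset_isRooted (ε z β : ℝ) (u : (EuclideanSpace ℝ d)) {Λ : Set (EuclideanSpace ℝ d)} (hΛ : (0 : (EuclideanSpace ℝ d)) ∈ Λ)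
    (Y : PointConfig ((EuclideanSpace ℝ d) × (EuclideanSpace ℝ d))) {A : Set (PointConfig ((EuclideanSpace ℝ d) × (EuclideanSpace ℝ d)))} (hA : A ⊆ {ω | IsRooted ω}) :
    gibbsSpec ε z β u Λ Y A = 0 := by
  rw [gibbsSpec, gibbsWeight_eq_zero_of_subset_isRooted ε z β u hΛ Y hA, ENNReal.zero_div]

/-- **A Gibbs state of the hard-sphere gas is a.s. NOT rooted**: `μ {ω | ∃ v, (0, v) ∈ ω} = 0`
(DLR equation in the window `closedBall 0 1`, Alexander 1976 §2.1 (2.1.1): positions inside a window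
are Lebesgue-distributed under the specification; no translation invariance is used).
[cite: Alexander1976, §2.1 (2.1.1)] -/
theorem measure_isRooted_eq_zero_of_isHardSphereGibbs {ε z β : ℝ} {u : (EuclideanSpace ℝ d)}
    {μ : Measure (PointConfig ((EuclideanSpace ℝ d) × (EuclideanSpace ℝ d)))} (h : IsHardSphereGibbs ε z β u μ) :
    μ {ω | IsRooted ω} = 0 := by
  rw [h.2 (Metric.closedBall (0 : (EuclideanSpace ℝ d)) 1) measurableSet_closedBall Metric.isBounded_closedBall
    {ω | IsRooted ω} measurableSet_isRooted]
  simp_rw [gibbsSpec_eq_zero_of_subset_isRooted ε z β u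
    (Metric.mem_closedBall_self (zero_le_one' ℝ)) _ (subset_refl {ω : PointConfig ((EuclideanSpace ℝ d) × (EuclideanSpace ℝ d)) | IsRooted ω})]
  exact lintegral_zero

/-- **A Gibbs MIXTURE is a.s. not rooted** (`Measure.bind_apply` + the previous lemma `π`-a.e.).
[folklore] -/
theorem measure_isRooted_eq_zero_of_isHardSphereGibbsMixture {ε : ℝ}
    {μ : Measure (PointConfig ((EuclideanSpace ℝ d) × (EuclideanSpace ℝ d)))} (h : IsHardSphereGibbsMixture ε μ) :
    μ {ω | IsRooted ω} = 0 := by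
  obtain ⟨π, κ, _, hκ, hae, rfl⟩ := h
  rw [Measure.bind_apply measurableSet_isRooted hκ.aemeasurable]
  refine (lintegral_congr_ae ?_).trans lintegral_zero
  filter_upwards [hae] with θ hθ
  exact measure_isRooted_eq_zero_of_isHardSphereGibbs hθ.2.2

/-- Hence a law carried by rooted configurations with positive total mass is never a Gibbs mixture.
[folklore] -/
theorem not_isHardSphereGibbsMixture_of_ae_isRooted {ε : ℝ} {Q : Measure (PointConfig ((EuclideanSpace ℝ d) × (EuclideanSpace ℝ d)))}
    (hQ : ∀ᵐ ω ∂Q, IsRooted ω) (hQ0 : Q ≠ 0) : ¬IsHardSphereGibbsMixture ε Q := by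
  intro h
  have h1 : Q {ω | IsRooted ω}ᶜ = 0 := by
    rw [ae_iff] at hQ
    exact hQ
  have h2 := measure_isRooted_eq_zero_of_isHardSphereGibbsMixture h
  have h3 : Q univ = 0 := by
    rw [← Set.union_compl_self {ω : PointConfig ((EuclideanSpace ℝ d) × (EuclideanSpace ℝ d)) | IsRooted ω}]
    exact nonpos_iff_eq_zero.1 ((measure_union_le _ _).trans_eq (by rw [h1, h2, add_zero]))
  exact hQ0 (Measure.measure_univ_eq_zero.1 h3)

end GibbsNotRooted

section PalmClass

open Literature.Analysis.FluidPDE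

/-- **L1 at tree level.** No member of the route's admissible class `𝓛(σ,e₀)`
(`IsPalmHardSphereState σ e₀`, the class in which crux `KiferYoungUpperR` stmt-13790 locates every
limit point of the rooted local state `R_N`) is a mixture of Gibbs states of the hard-sphere gas
(`IsHardSphereGibbsMixture`, the conclusion class of `PesinSaturationRigidityR` stmt-13806 (a′) that
`PricedBoltzmannHypothesis` quotes as "hence ν is a mixture of Gibbs laws g_{z,u,β}") — for ANY
diameter `ε`, any `σ > 0`, any `e₀` (Palm laws live on rooted configurations, Last–Penrose (9.7)).
[cite: LastPenrose2017, (9.7)] -/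
theorem IsPalmHardSphereState.not_isHardSphereGibbsMixture {σ e₀ ε : ℝ}
    {Q : Measure (PointConfig (V3 × V3))} (h : IsPalmHardSphereState σ e₀ Q) (hσ : 0 < σ) :
    ¬IsHardSphereGibbsMixture ε Q := by
  haveI := h.isProbabilityMeasure hσ
  exact not_isHardSphereGibbsMixture_of_ae_isRooted h.ae_isRooted (IsProbabilityMeasure.ne_zero Q)

/-- The same for the bare Palm law of any law with positive finite intensity (e.g. the Palm law of
the equilibrium Gibbs state itself — the local limit in the degenerate instance of constant
profiles `a₀ ≡ 1, u₀ ≡ 0, θ₀ ≡ θe`, where the evolved law is `G_N` at every time).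
[cite: LastPenrose2017, (9.7)] -/
theorem palmLaw_not_isHardSphereGibbsMixture {ε : ℝ} (P : Measure (PointConfig (V3 × V3))) [SFinite P]
    (h0 : intensity P ≠ 0) (htop : intensity P ≠ ∞) : ¬IsHardSphereGibbsMixture ε (palmLaw P) := by
  haveI := isProbabilityMeasure_palmLaw P h0 htop
  exact not_isHardSphereGibbsMixture_of_ae_isRooted (palmLaw_ae_isRooted P)
    (IsProbabilityMeasure.ne_zero _)

end PalmClass

end Summit.AtomisticToContinuum.HydrodynamicLimit.Theorems.PricedBoltzmannHypothesis.Negative
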